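import Literature.Dynamics.TransferOperators.MayerTransferOperatorBounds
import Mathlib.Analysis.Complex.Schwarz
import Mathlib.Analysis.Calculus.FDeriv.CompCLM
import Mathlib.Analysis.Normed.Operator.Bilinear
import HarnessLib

/-!
# Mayer's transfer operator — existence and holomorphy of the family `s ↦ L_s`

Companion file to `MayerTransferOperator.lean` (definitions) and `MayerTransferOperatorBounds.lean`
(estimates for the Hurwitz zeta function with complex parameter). Here we prove the named fact
`MayerTransferHolomorphic` of the definitions file:

* `MayerTransferHolomorphic_holds` — `s ↦ L_s` is holomorphic, as a map into the Banach space of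
  bounded operators on `B(D)`, on `U = {0 < Re s} \ {1/2}` [Mayer1990, Thm. 5].

## The argument

We follow the `N = 0` case of Mayer's proof of [Mayer1990, Thm. 5, eqs. (58)–(62), pp. 325–327]:
for `f ∈ B(D) = A_∞(D)` write `f = f(0) + P₀ f` with `(P₀ f)(z) = f(z) - f(0)`, `|P₀ f (z)| ≤ C |z|`
near `0`; then

  `L_s f = f(0) · ζ(2s, · + 1) + ∑_{n ≥ 1} (· + n)^{-2s} (P₀ f)(1/(· + n))`,

where the series over the inverse branches now converges absolutely and uniformly on `D̄` as soon
as `2 Re s + 1 > 1`, i.e. `Re s > 0` (p. 327), and `ζ(2s, z + 1)` is holomorphic in `z` and in `s`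
away from the single pole `s = 1/2` (p. 326, via Hermite's formula (63); here via the convergent
series `hurwitzZetaC` of the definitions file and the estimates of the bounds file).

Mayer obtains holomorphy in `s` from nuclearity of the operators; lacking nuclear operators in
Mathlib we instead prove it directly by the Weierstrass `M`-test IN OPERATOR NORM
(`Complex.differentiableOn_tsum_of_summable_norm` with values in `B(D) →L[ℂ] B(D)`): each branch
operator `A_n(s) f = (· + n + 1)^{-2s} · (f(1/(· + n + 1)) - f(0))` is entire in `s` (it is the
composition of a fixed bounded operator with multiplication by the `B(D)`-valued entire curve
`s ↦ (· + n + 1)^{-2s} = exp(-2s log(· + n + 1))`), with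
`‖A_n(s)‖ ≤ 4 e^{π |Im s|} (n + 1/2)^{-(2 Re s + 1)}` by the Schwarz lemma
(`|f(w) - f(0)| ≤ 4 ‖f‖ |w|` on `D̄`).

## Contents

* pointwise API for `MayerSpace` (`toFun` of differences, scalar multiples, sums of series);
* `MayerSpace.norm_sub_apply_zero_le` — the Schwarz-lemma estimate `|f(w) - f(0)| ≤ 4‖f‖ |w|`;
* `MayerSpace.mul`, `mulOp` — pointwise multiplication as a bounded bilinear map on `B(D)`;
* `expCurve L t = exp(t L)` (pointwise), an entire `B(D)`-valued curve, `hasDerivAt_expCurve`;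
* `logElt m = log(· + m + 1) ∈ B(D)`, so that `expCurve (logElt m) w = (· + m + 1)^w`;
* `branchOp n` (`f ↦ f(1/(· + n + 1)) - f(0)`), `branchTerm n s = A_n(s)`, their bounds;
* `hurwitzTermElt n s`, `hurwitzElt s = ζ(2s, · + 1) ∈ B(D)` and their holomorphy in `s`;
* `mayerFamily s = L_s` (explicit), `isMayerTransferAt_mayerFamily`, `differentiableOn_mayerFamily`,
  `mayerTransfer_eq_mayerFamily`, `MayerTransferHolomorphic_holds`.

## References

* [Mayer1990] D. Mayer, On the thermodynamic formalism for the Gauss map, Comm. Math. Phys. 130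
  (1990) 311–333; Thm. 5 and its proof, eqs. (58)–(63), pp. 325–327.
-/

noncomputable section

open Complex Metric Set Filter Real
open _root_.Topology

namespace Literature.Dynamics.TransferOperators

/-! ### Pointwise API for `B(D)` -/

namespace MayerSpace

/-- Point values of a difference. [folklore] -/
theorem toFun_sub_apply (f g : MayerSpace) {z : ℂ} (hz : z ∈ mayerClosedDisc) :
    (f - g).toFun z = f.toFun z - g.toFun z := by
  rw [toFun_apply _ hz, toFun_apply _ hz, toFun_apply _ hz]
  rfl

/-- Point values of a sum. [folklore] -/
theorem toFun_add_apply (f g : MayerSpace) {z : ℂ} (hz : z ∈ mayerClosedDisc) :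
    (f + g).toFun z = f.toFun z + g.toFun z := by
  rw [toFun_apply _ hz, toFun_apply _ hz, toFun_apply _ hz]
  rfl

/-- Point values of a scalar multiple. [folklore] -/
theorem toFun_smul_apply (c : ℂ) (f : MayerSpace) {z : ℂ} (hz : z ∈ mayerClosedDisc) :
    (c • f).toFun z = c * f.toFun z := by
  rw [toFun_apply _ hz, toFun_apply _ hz]
  rfl

/-- Point values of the sum of a convergent series in `B(D)`. [folklore] -/
theorem toFun_tsum_apply {ι : Type*} {F : ι → MayerSpace} (hF : Summable F) {z : ℂ}
    (hz : z ∈ mayerClosedDisc) : (∑' i, F i).toFun z = ∑' i, (F i).toFun z := by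
  have h := (evalCLM ⟨z, hz⟩).map_tsum hF
  simpa only [evalCLM_apply] using h

/-- The norm of an element of `B(D)` is nonnegative... and point values at `0` are bounded by it;
a convenient form: `‖f(w)‖ + ‖f(0)‖ ≤ 2 ‖f‖`. [folklore] -/
theorem norm_toFun_add_norm_toFun_zero_le (f : MayerSpace) {w : ℂ} (hw : w ∈ mayerClosedDisc) :
    ‖f.toFun w‖ + ‖f.toFun 0‖ ≤ 2 * ‖f‖ := by
  have h1 := f.norm_toFun_le hw
  have h2 := f.norm_toFun_le zero_mem_mayerClosedDisc
  linarith

/-- The ball `|w| < 1/2` lies in Mayer's disc. [folklore] -/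
theorem ball_zero_half_subset_mayerDisc : ball (0 : ℂ) (1 / 2) ⊆ mayerDisc := by
  intro w hw
  rw [mem_ball, dist_eq_norm, sub_zero] at hw
  rw [mem_mayerDisc, dist_eq_norm]
  have h1 : ‖w - 1‖ ≤ ‖w‖ + 1 := by simpa using norm_sub_le w 1
  linarith

/-- **Schwarz-lemma estimate at the origin**: for `f ∈ B(D)` and `w ∈ D̄`,
`‖f(w) - f(0)‖ ≤ 4 ‖f‖ ‖w‖`. (For `|w| < 1/2` this is the Schwarz lemma on the ball
`|w| < 1/2 ⊆ D`, where `|f - f(0)| ≤ 2‖f‖`; for `|w| ≥ 1/2` it is the trivial bound `2‖f‖`.)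
This is the estimate `|P_N f (z)| ≤ C |z|^{N+1}` of [Mayer1990, (58)] for `N = 0`. [folklore] -/
theorem norm_sub_apply_zero_le (f : MayerSpace) {w : ℂ} (hw : w ∈ mayerClosedDisc) :
    ‖f.toFun w - f.toFun 0‖ ≤ 4 * ‖f‖ * ‖w‖ := by
  have htriv : ‖f.toFun w - f.toFun 0‖ ≤ 2 * ‖f‖ :=
    (norm_sub_le _ _).trans (f.norm_toFun_add_norm_toFun_zero_le hw)
  by_cases h : ‖w‖ < 1 / 2
  · have hd : DifferentiableOn ℂ f.toFun (ball (0 : ℂ) (1 / 2)) :=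
      f.differentiableOn_toFun.mono ball_zero_half_subset_mayerDisc
    have hmaps : MapsTo f.toFun (ball (0 : ℂ) (1 / 2)) (closedBall (f.toFun 0) (2 * ‖f‖)) := by
      intro u hu
      rw [mem_closedBall, dist_eq_norm]
      exact (norm_sub_le _ _).trans (f.norm_toFun_add_norm_toFun_zero_le
        (mayerDisc_subset_mayerClosedDisc (ball_zero_half_subset_mayerDisc hu)))
    have hz : w ∈ ball (0 : ℂ) (1 / 2) := by rwa [mem_ball, dist_eq_norm, sub_zero]
    have key := Complex.dist_le_div_mul_dist_of_mapsTo_ball hd hmaps hz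
    rw [dist_eq_norm, dist_eq_norm, sub_zero] at key
    calc ‖f.toFun w - f.toFun 0‖ ≤ 2 * ‖f‖ / (1 / 2) * ‖w‖ := key
      _ = 4 * ‖f‖ * ‖w‖ := by ring
  · have h : 1 / 2 ≤ ‖w‖ := not_lt.mp h
    calc ‖f.toFun w - f.toFun 0‖ ≤ 2 * ‖f‖ := htriv
      _ = 4 * ‖f‖ * (1 / 2) := by ring
      _ ≤ 4 * ‖f‖ * ‖w‖ := mul_le_mul_of_nonneg_left h (by positivity)

/-! ### Pointwise multiplication on `B(D)` -/

/-- Pointwise product of two elements of `B(D)` (holomorphic · holomorphic, continuous ·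
continuous). [folklore] -/
def mul (g f : MayerSpace) : MayerSpace :=
  mk (fun z => g.toFun z * f.toFun z) (g.continuousOn_toFun.mul f.continuousOn_toFun)
    (g.differentiableOn_toFun.mul f.differentiableOn_toFun)

/-- Point values of the product. [folklore] -/
theorem mul_toFun_apply (g f : MayerSpace) {z : ℂ} (hz : z ∈ mayerClosedDisc) :
    (mul g f).toFun z = g.toFun z * f.toFun z :=
  mk_toFun_apply _ _ _ hz

/-- Submultiplicativity of the sup norm. [folklore] -/
theorem norm_mul_le (g f : MayerSpace) : ‖mul g f‖ ≤ ‖g‖ * ‖f‖ := by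
  refine norm_le_of_forall_le _ (by positivity) fun z hz => ?_
  rw [mul_toFun_apply g f hz, norm_mul]
  exact mul_le_mul (g.norm_toFun_le hz) (f.norm_toFun_le hz) (norm_nonneg _) (norm_nonneg _)

/-- **Multiplication operators**: `g ↦ (f ↦ g · f)` as a bounded bilinear map on `B(D)`.
[folklore] -/
def mulOp : MayerSpace →L[ℂ] MayerSpace →L[ℂ] MayerSpace :=
  LinearMap.mkContinuous₂
    (LinearMap.mk₂ ℂ mul
      (fun g₁ g₂ f => ext fun z hz => by
        simp only [mul_toFun_apply _ _ hz, toFun_add_apply _ _ hz]; ring)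
      (fun c g f => ext fun z hz => by
        simp only [mul_toFun_apply _ _ hz, toFun_smul_apply _ _ hz]; ring)
      (fun g f₁ f₂ => ext fun z hz => by
        simp only [mul_toFun_apply _ _ hz, toFun_add_apply _ _ hz]; ring)
      (fun c g f => ext fun z hz => by
        simp only [mul_toFun_apply _ _ hz, toFun_smul_apply _ _ hz]; ring))
    1 (fun g f => by rw [one_mul]; exact norm_mul_le g f)

/-- `mulOp g f = mul g f`. [folklore] -/
@[simp] theorem mulOp_apply (g f : MayerSpace) : mulOp g f = mul g f := rfl

/-! ### Exponential curves in `B(D)` -/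

/-- For `L ∈ B(D)` and `t ∈ ℂ`, the element `exp(t L) ∈ B(D)` (pointwise exponential).
[folklore] -/
def expCurve (L : MayerSpace) (t : ℂ) : MayerSpace :=
  mk (fun z => exp (t * L.toFun z)) ((continuousOn_const.mul L.continuousOn_toFun).cexp)
    (((differentiableOn_const t).mul L.differentiableOn_toFun).cexp)

/-- Point values of `expCurve L t`. [folklore] -/
theorem expCurve_toFun_apply (L : MayerSpace) (t : ℂ) {z : ℂ} (hz : z ∈ mayerClosedDisc) :
    (expCurve L t).toFun z = exp (t * L.toFun z) :=
  mk_toFun_apply _ _ _ hz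

/-- **The curve `t ↦ exp(t L)` is complex-differentiable in `B(D)`** with derivative
`L · exp(t L)`: the remainder `exp(tℓ)(exp(hℓ) - 1 - hℓ)` is bounded by `‖exp(t L)‖ ‖L‖² |h|²`
uniformly on `D̄` (`‖exp x - 1 - x‖ ≤ ‖x‖²` for `‖x‖ ≤ 1`). [folklore] -/
theorem hasDerivAt_expCurve (L : MayerSpace) (t : ℂ) :
    HasDerivAt (expCurve L) (mul L (expCurve L t)) t := by
  rw [hasDerivAt_iff_isLittleO_nhds_zero, Asymptotics.isLittleO_iff]
  intro ε hε
  set M : ℝ := ‖expCurve L t‖ with hMdef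
  set Λ : ℝ := ‖L‖ with hΛdef
  have hM : 0 ≤ M := norm_nonneg _
  have hΛ : 0 ≤ Λ := norm_nonneg _
  obtain ⟨δ, hδ, hδ1, hδ2⟩ : ∃ δ : ℝ, 0 < δ ∧ δ ≤ 1 / (Λ + 1) ∧ δ ≤ ε / ((M + 1) * (Λ + 1) ^ 2) :=
    ⟨min (1 / (Λ + 1)) (ε / ((M + 1) * (Λ + 1) ^ 2)), lt_min (by positivity) (by positivity),
      min_le_left _ _, min_le_right _ _⟩
  filter_upwards [Metric.ball_mem_nhds (0 : ℂ) hδ] with h hh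
  rw [mem_ball_zero_iff] at hh
  have hh1 : ‖h‖ ≤ 1 / (Λ + 1) := hh.le.trans hδ1
  have hh2 : ‖h‖ ≤ ε / ((M + 1) * (Λ + 1) ^ 2) := hh.le.trans hδ2
  refine norm_le_of_forall_le _ (by positivity) fun z hz => ?_
  have hℓ : ‖L.toFun z‖ ≤ Λ := L.norm_toFun_le hz
  have hexp : ‖exp (t * L.toFun z)‖ ≤ M := by
    rw [← expCurve_toFun_apply L t hz]; exact (expCurve L t).norm_toFun_le hz
  have hval : (expCurve L (t + h) - expCurve L t - h • mul L (expCurve L t)).toFun z =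
      exp (t * L.toFun z) * (exp (h * L.toFun z) - 1 - h * L.toFun z) := by
    rw [toFun_sub_apply _ _ hz, toFun_sub_apply _ _ hz, toFun_smul_apply _ _ hz,
      mul_toFun_apply _ _ hz, expCurve_toFun_apply _ _ hz, expCurve_toFun_apply _ _ hz,
      add_mul, Complex.exp_add]
    ring
  have hx : ‖h * L.toFun z‖ ≤ 1 := by
    rw [norm_mul]
    calc ‖h‖ * ‖L.toFun z‖ ≤ 1 / (Λ + 1) * Λ :=
          mul_le_mul hh1 hℓ (norm_nonneg _) (by positivity)
      _ ≤ 1 / (Λ + 1) * (Λ + 1) := mul_le_mul_of_nonneg_left (by linarith) (by positivity)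
      _ = 1 := by field_simp
  rw [hval, norm_mul]
  calc ‖exp (t * L.toFun z)‖ * ‖exp (h * L.toFun z) - 1 - h * L.toFun z‖
      ≤ M * ‖h * L.toFun z‖ ^ 2 :=
        mul_le_mul hexp (Complex.norm_exp_sub_one_sub_id_le hx) (norm_nonneg _) hM
    _ = (M * ‖L.toFun z‖ ^ 2 * ‖h‖) * ‖h‖ := by rw [norm_mul]; ring
    _ ≤ ε * ‖h‖ := by
        refine mul_le_mul_of_nonneg_right ?_ (norm_nonneg _)
        calc M * ‖L.toFun z‖ ^ 2 * ‖h‖ ≤ (M + 1) * (Λ + 1) ^ 2 * ‖h‖ := by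
              refine mul_le_mul_of_nonneg_right ?_ (norm_nonneg _)
              refine mul_le_mul (by linarith) ?_ (by positivity) (by positivity)
              exact pow_le_pow_left₀ (norm_nonneg _) (by linarith) 2
          _ ≤ (M + 1) * (Λ + 1) ^ 2 * (ε / ((M + 1) * (Λ + 1) ^ 2)) :=
              mul_le_mul_of_nonneg_left hh2 (by positivity)
          _ = ε := by field_simp

/-- `t ↦ exp(t L)` is an entire `B(D)`-valued curve. [folklore] -/
theorem differentiable_expCurve (L : MayerSpace) : Differentiable ℂ (expCurve L) :=
  fun t => (hasDerivAt_expCurve L t).differentiableAt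

/-- `s ↦ exp(-2s L)` is entire. [folklore] -/
theorem differentiable_expCurve_neg_two_mul (L : MayerSpace) :
    Differentiable ℂ fun s : ℂ => expCurve L (-(2 * s)) :=
  (differentiable_expCurve L).comp (by fun_prop)

/-- `s ↦ exp((1 - 2s) L)` is entire. [folklore] -/
theorem differentiable_expCurve_one_sub_two_mul (L : MayerSpace) :
    Differentiable ℂ fun s : ℂ => expCurve L (1 - 2 * s) :=
  (differentiable_expCurve L).comp (by fun_prop)

/-! ### Logarithms and powers of `z + m + 1` as elements of `B(D)` -/

/-- On the closed disc, `z + m + 1` lies in the slit plane (`Re > 0`). [folklore] -/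
theorem add_natCast_add_one_mem_slitPlane {z : ℂ} (hz : z ∈ mayerClosedDisc) (m : ℕ) :
    z + (m + 1) ∈ slitPlane :=
  mem_slitPlane_iff.mpr (Or.inl (re_add_pos_of_mem_mayerClosedDisc hz m))

/-- On the closed disc, `z + m + 1 ≠ 0`. [folklore] -/
theorem add_natCast_add_one_ne_zero {z : ℂ} (hz : z ∈ mayerClosedDisc) (m : ℕ) :
    z + (m + 1) ≠ 0 := fun h => by
  have h1 := re_add_pos_of_mem_mayerClosedDisc hz m
  rw [h, zero_re] at h1
  exact lt_irrefl _ h1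

/-- `log(· + m + 1) ∈ B(D)` (principal branch; `Re (z + m + 1) > 0` on `D̄`). [folklore] -/
def logElt (m : ℕ) : MayerSpace :=
  mk (fun z => log (z + (m + 1)))
    (fun _ hz => ((differentiableAt_id.add_const _).clog
      (add_natCast_add_one_mem_slitPlane hz m)).continuousAt.continuousWithinAt)
    (fun _ hz => ((differentiableAt_id.add_const _).clog
      (add_natCast_add_one_mem_slitPlane (mayerDisc_subset_mayerClosedDisc hz) m))
        |>.differentiableWithinAt)

/-- Point values of `logElt m`. [folklore] -/
theorem logElt_toFun_apply (m : ℕ) {z : ℂ} (hz : z ∈ mayerClosedDisc) :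
    (logElt m).toFun z = log (z + (m + 1)) :=
  mk_toFun_apply _ _ _ hz

/-- **Powers**: `exp(w log(· + m + 1)) = (· + m + 1)^w` on `D̄` (principal branch). [folklore] -/
theorem expCurve_logElt_toFun_apply (m : ℕ) (w : ℂ) {z : ℂ} (hz : z ∈ mayerClosedDisc) :
    (expCurve (logElt m) w).toFun z = (z + (m + 1)) ^ w := by
  rw [expCurve_toFun_apply _ _ hz, logElt_toFun_apply m hz,
    cpow_def_of_ne_zero (add_natCast_add_one_ne_zero hz m), mul_comm]

/-- Sup-norm bound for the powers with `Re w ≤ 0`: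
`‖(· + m + 1)^w‖ ≤ (m + 1/2)^{Re w} e^{π/2 |Im w|}` (`Re (z + m + 1) ≥ m + 1/2` on `D̄`).
[folklore] -/
theorem norm_expCurve_logElt_le (m : ℕ) {w : ℂ} (hw : w.re ≤ 0) :
    ‖expCurve (logElt m) w‖ ≤ ((m : ℝ) + 1 / 2) ^ w.re * Real.exp (π / 2 * |w.im|) := by
  refine norm_le_of_forall_le _ (by positivity) fun z hz => ?_
  rw [expCurve_logElt_toFun_apply m w hz]
  have hre : 0 < (z + (m + 1)).re := re_add_pos_of_mem_mayerClosedDisc hz m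
  refine (norm_cpow_le_re_rpow_of_re_pos hre hw).trans ?_
  refine mul_le_mul_of_nonneg_right ?_ (Real.exp_pos _).le
  refine Real.rpow_le_rpow_of_nonpos (by positivity) ?_ hw
  have h1 := re_ge_of_mem_mayerClosedDisc hz
  have h2 : (z + (m + 1)).re = z.re + (m + 1) := by simp
  rw [h2]
  linarith

end MayerSpace

open MayerSpace

/-! ### The branch operators `f ↦ f(1/(· + n + 1)) - f(0)` -/

/-- The inverse branch `z ↦ 1/(z + n + 1)` is continuous on `D̄`. [folklore] -/
theorem continuousOn_branch (n : ℕ) :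
    ContinuousOn (fun z : ℂ => 1 / (z + (n + 1))) mayerClosedDisc :=
  continuousOn_const.div (continuousOn_id.add continuousOn_const)
    fun _ hz => add_natCast_add_one_ne_zero hz n

/-- The inverse branch `z ↦ 1/(z + n + 1)` is holomorphic on `D`. [folklore] -/
theorem differentiableOn_branch (n : ℕ) :
    DifferentiableOn ℂ (fun z : ℂ => 1 / (z + (n + 1))) mayerDisc :=
  (differentiableOn_const _).div (differentiableOn_id.add (differentiableOn_const _))
    fun _ hz => add_natCast_add_one_ne_zero (mayerDisc_subset_mayerClosedDisc hz) n

/-- On `D̄`, `‖1/(z + n + 1)‖ ≤ (n + 1/2)⁻¹`. [folklore] -/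
theorem norm_branch_le {z : ℂ} (hz : z ∈ mayerClosedDisc) (n : ℕ) :
    ‖1 / (z + (n + 1))‖ ≤ ((n : ℝ) + 1 / 2)⁻¹ := by
  have hre : (z + (n + 1)).re = z.re + (n + 1) := by simp
  have h1 := re_ge_of_mem_mayerClosedDisc hz
  have h2 : (n : ℝ) + 1 / 2 ≤ ‖z + (n + 1)‖ :=
    le_trans (by rw [hre]; linarith) (re_le_norm _)
  rw [norm_div, norm_one, one_div]
  exact inv_anti₀ (by positivity) h2

/-- `P₀`-composed branch map of [Mayer1990, (59)–(60)] (`N = 0`): the bounded operator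
`f ↦ f(1/(· + n + 1)) - f(0)` on `B(D)`. [cite: Mayer1990, eqs. (59)–(60)] -/
def branchOp (n : ℕ) : MayerSpace →L[ℂ] MayerSpace :=
  LinearMap.mkContinuous
    { toFun := fun f => mk (fun z => f.toFun (1 / (z + (n + 1))) - f.toFun 0)
        ((f.continuousOn_toFun.comp (continuousOn_branch n)
          fun _ hz => one_div_add_mem_mayerClosedDisc hz n).sub continuousOn_const)
        ((f.differentiableOn_toFun.comp (differentiableOn_branch n)
          fun _ hz => one_div_add_mem_mayerDisc (mayerDisc_subset_mayerClosedDisc hz) n).sub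
          (differentiableOn_const _))
      map_add' := fun f g => MayerSpace.ext fun z hz => by
        simp only [mk_toFun_apply _ _ _ hz, toFun_add_apply _ _ hz, toFun_add,
          Pi.add_apply]
        ring
      map_smul' := fun c f => MayerSpace.ext fun z hz => by
        simp only [mk_toFun_apply _ _ _ hz, toFun_smul_apply _ _ hz, toFun_smul,
          Pi.smul_apply, smul_eq_mul, RingHom.id_apply]
        ring }
    2 fun f => by
      refine norm_le_of_forall_le _ (by positivity) fun z hz => ?_
      simp only [LinearMap.coe_mk, AddHom.coe_mk, mk_toFun_apply _ _ _ hz]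
      exact (norm_sub_le _ _).trans
        (f.norm_toFun_add_norm_toFun_zero_le (one_div_add_mem_mayerClosedDisc hz n))

/-- Point values of `branchOp n f`. [folklore] -/
theorem branchOp_toFun_apply (n : ℕ) (f : MayerSpace) {z : ℂ} (hz : z ∈ mayerClosedDisc) :
    (branchOp n f).toFun z = f.toFun (1 / (z + (n + 1))) - f.toFun 0 := by
  simp only [branchOp, LinearMap.mkContinuous_apply, LinearMap.coe_mk, AddHom.coe_mk,
    mk_toFun_apply _ _ _ hz]

/-- **The decay in `n`** (Schwarz lemma): `‖branchOp n f‖ ≤ 4 ‖f‖ (n + 1/2)⁻¹`. This is where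
`|P₀ f (z)| ≤ C |z|` [Mayer1990, (58)] enters. [folklore] -/
theorem norm_branchOp_le (n : ℕ) (f : MayerSpace) :
    ‖branchOp n f‖ ≤ 4 * ‖f‖ * ((n : ℝ) + 1 / 2)⁻¹ := by
  refine norm_le_of_forall_le _ (by positivity) fun z hz => ?_
  rw [branchOp_toFun_apply n f hz]
  refine (f.norm_sub_apply_zero_le (one_div_add_mem_mayerClosedDisc hz n)).trans ?_
  exact mul_le_mul_of_nonneg_left (norm_branch_le hz n) (by positivity)

/-! ### The branch terms `A_n(s) : f ↦ (· + n + 1)^{-2s} (f(1/(· + n + 1)) - f(0))` -/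

/-- `(· + n + 1)^{-2s} ∈ B(D)`. [folklore] -/
def powElt (n : ℕ) (s : ℂ) : MayerSpace := expCurve (logElt n) (-(2 * s))

/-- Point values of `powElt n s`. [folklore] -/
theorem powElt_toFun_apply (n : ℕ) (s : ℂ) {z : ℂ} (hz : z ∈ mayerClosedDisc) :
    (powElt n s).toFun z = (z + (n + 1)) ^ (-(2 * s)) :=
  expCurve_logElt_toFun_apply n _ hz

/-- `‖(· + n + 1)^{-2s}‖ ≤ (n + 1/2)^{-2 Re s} e^{π |Im s|}` for `Re s ≥ 0`. [folklore] -/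
theorem norm_powElt_le (n : ℕ) {s : ℂ} (hs : 0 ≤ s.re) :
    ‖powElt n s‖ ≤ ((n : ℝ) + 1 / 2) ^ (-(2 * s.re)) * Real.exp (π * |s.im|) := by
  have hre : (-(2 * s)).re = -(2 * s.re) := by simp
  have him : |(-(2 * s)).im| = 2 * |s.im| := by simp [abs_mul]
  have h := norm_expCurve_logElt_le n (w := -(2 * s)) (by rw [hre]; linarith)
  rw [hre, him] at h
  convert h using 2
  congr 1
  ring

/-- `s ↦ (· + n + 1)^{-2s}` is an entire `B(D)`-valued map. [folklore] -/
theorem differentiable_powElt (n : ℕ) : Differentiable ℂ (powElt n) :=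
  differentiable_expCurve_neg_two_mul (logElt n)

/-- **The `n`-th branch term of `L_s`** (`n + 1`-st inverse branch, composed with `P₀`):
`A_n(s) f = (· + n + 1)^{-2s} · (f(1/(· + n + 1)) - f(0))`. [cite: Mayer1990, eq. (62)] -/
def branchTerm (n : ℕ) (s : ℂ) : MayerSpace →L[ℂ] MayerSpace :=
  (mulOp (powElt n s)).comp (branchOp n)

/-- Point values of `A_n(s) f`. [folklore] -/
theorem branchTerm_toFun_apply (n : ℕ) (s : ℂ) (f : MayerSpace) {z : ℂ}
    (hz : z ∈ mayerClosedDisc) :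
    (branchTerm n s f).toFun z =
      (z + (n + 1)) ^ (-(2 * s)) * (f.toFun (1 / (z + (n + 1))) - f.toFun 0) := by
  rw [branchTerm, ContinuousLinearMap.comp_apply, mulOp_apply, mul_toFun_apply _ _ hz,
    powElt_toFun_apply n s hz, branchOp_toFun_apply n f hz]

/-- **Operator-norm bound**: `‖A_n(s)‖ ≤ 4 e^{π |Im s|} (n + 1/2)^{-(2 Re s + 1)}` for
`Re s ≥ 0`. [folklore] -/
theorem norm_branchTerm_le (n : ℕ) {s : ℂ} (hs : 0 ≤ s.re) :
    ‖branchTerm n s‖ ≤ 4 * Real.exp (π * |s.im|) * ((n : ℝ) + 1 / 2) ^ (-(2 * s.re + 1)) := by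
  have hx : (0 : ℝ) < (n : ℝ) + 1 / 2 := by positivity
  refine ContinuousLinearMap.opNorm_le_bound _ (by positivity) fun f => ?_
  rw [branchTerm, ContinuousLinearMap.comp_apply, mulOp_apply]
  calc ‖mul (powElt n s) (branchOp n f)‖ ≤ ‖powElt n s‖ * ‖branchOp n f‖ := norm_mul_le _ _
    _ ≤ (((n : ℝ) + 1 / 2) ^ (-(2 * s.re)) * Real.exp (π * |s.im|)) *
          (4 * ‖f‖ * ((n : ℝ) + 1 / 2)⁻¹) :=
        mul_le_mul (norm_powElt_le n hs) (norm_branchOp_le n f) (norm_nonneg _) (by positivity)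
    _ = 4 * Real.exp (π * |s.im|) * ((n : ℝ) + 1 / 2) ^ (-(2 * s.re + 1)) * ‖f‖ := by
        rw [neg_add, Real.rpow_add hx, Real.rpow_neg_one]
        ring

/-- `s ↦ A_n(s)` is entire (operator norm). [folklore] -/
theorem differentiable_branchTerm (n : ℕ) : Differentiable ℂ (branchTerm n) := by
  have h0 : Differentiable ℂ (⇑(mulOp : MayerSpace →L[ℂ] MayerSpace →L[ℂ] MayerSpace)) :=
    ContinuousLinearMap.differentiable (𝕜 := ℂ) (E := MayerSpace)
      (F := MayerSpace →L[ℂ] MayerSpace) mulOp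
  have h1 : Differentiable ℂ (fun s => mulOp (powElt n s)) :=
    Differentiable.comp (𝕜 := ℂ) (E := ℂ) (F := MayerSpace) (G := MayerSpace →L[ℂ] MayerSpace)
      h0 (differentiable_powElt n)
  exact Differentiable.clm_comp (𝕜 := ℂ) (E := ℂ) (F := MayerSpace) (G := MayerSpace)
    (H := MayerSpace) (c := fun s => mulOp (powElt n s)) (d := fun _ => branchOp n) h1
    (differentiable_const (branchOp n))

/-- **Absolute convergence of `∑ₙ A_n(s)` in operator norm** for `Re s > 0` ("the sum converges
uniformly and absolutely in `D` for `2 Re β + N + 1 > 1`", [Mayer1990, p. 327], `N = 0`).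
[cite: Mayer1990, Thm. 5 (proof, p. 327)] -/
theorem summable_branchTerm {s : ℂ} (hs : 0 < s.re) : Summable fun n => branchTerm n s := by
  have h2 : (0 : ℝ) < 2 * s.re := by positivity
  have h12 : (0 : ℝ) < 1 / 2 := by norm_num
  exact Summable.of_norm_bounded (E := MayerSpace →L[ℂ] MayerSpace)
    ((summable_nat_add_rpow_neg h12 h2).mul_left (4 * Real.exp (π * |s.im|)))
    fun n => norm_branchTerm_le n hs.le

/-! ### A local Weierstrass `M`-test for holomorphy -/

/-- Two-exponent domination: for `0 < x` and `a₁ ≤ a ≤ a₂`, `x^{-a} ≤ x^{-a₁} + x^{-a₂}`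
(case `x ≥ 1`: first term; case `x ≤ 1`: second term). [folklore] -/
theorem rpow_neg_le_add {x a a₁ a₂ : ℝ} (hx : 0 < x) (h₁ : a₁ ≤ a) (h₂ : a ≤ a₂) :
    x ^ (-a) ≤ x ^ (-a₁) + x ^ (-a₂) := by
  rcases le_or_gt 1 x with hx1 | hx1
  · have h : x ^ (-a) ≤ x ^ (-a₁) := Real.rpow_le_rpow_of_exponent_le hx1 (by linarith)
    linarith [Real.rpow_nonneg hx.le (-a₂)]
  · have h : x ^ (-a) ≤ x ^ (-a₂) :=
      Real.rpow_le_rpow_of_exponent_ge hx hx1.le (by linarith)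
    linarith [Real.rpow_nonneg hx.le (-a₁)]

/-- Elementary bounds for `s` in the disc `|s - s₀| < r`. [folklore] -/
theorem bounds_of_mem_ball {s s₀ : ℂ} {r : ℝ} (hs : s ∈ ball s₀ r) :
    s₀.re - r ≤ s.re ∧ s.re ≤ s₀.re + r ∧ |s.im| ≤ |s₀.im| + r ∧ ‖s‖ ≤ ‖s₀‖ + r := by
  rw [mem_ball, dist_eq_norm] at hs
  have h1 : |(s - s₀).re| ≤ ‖s - s₀‖ := abs_re_le_norm _
  have h2 : |(s - s₀).im| ≤ ‖s - s₀‖ := abs_im_le_norm _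
  rw [sub_re, abs_le] at h1
  rw [sub_im] at h2
  refine ⟨by linarith [h1.1], by linarith [h1.2], ?_, ?_⟩
  · have h3 := abs_sub_abs_le_abs_sub s.im s₀.im
    linarith
  · have h3 := norm_sub_norm_le s s₀
    linarith

/-- **Local Weierstrass `M`-test for holomorphy** of a series `∑ₙ Fₙ(s)` with values in a complex
Banach space: termwise holomorphy on an open set `W` plus, near every point of `W`, a summable
majorant of the norms. (`Complex.differentiableOn_tsum_of_summable_norm` on small discs.)
[folklore] -/
theorem differentiableOn_tsum_of_locally_bounded {E : Type*} [NormedAddCommGroup E]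
    [NormedSpace ℂ E] [CompleteSpace E] {F : ℕ → ℂ → E} {W : Set ℂ} (hW : IsOpen W)
    (hF : ∀ n, DifferentiableOn ℂ (F n) W)
    (hloc : ∀ s₀ ∈ W, ∃ r > 0, ∃ u : ℕ → ℝ, Summable u ∧
      ∀ n, ∀ s ∈ ball s₀ r, s ∈ W → ‖F n s‖ ≤ u n) :
    DifferentiableOn ℂ (fun s => ∑' n, F n s) W := by
  intro s₀ hs₀
  obtain ⟨r, hr, u, hu, hb⟩ := hloc s₀ hs₀
  have hV : IsOpen (ball s₀ r ∩ W) := isOpen_ball.inter hW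
  have h := Complex.differentiableOn_tsum_of_summable_norm hu
    (fun n => (hF n).mono inter_subset_right) hV (fun n s hs => hb n s hs.1 hs.2)
  exact (h.differentiableAt (hV.mem_nhds ⟨mem_ball_self hr, hs₀⟩)).differentiableWithinAt

/-- **Holomorphy of `s ↦ ∑ₙ A_n(s)` on `{Re s > 0}`** in operator norm, by the local `M`-test with
the bound `‖A_n(s)‖ ≤ 4 e^{π |Im s|} (n + 1/2)^{-(2 Re s + 1)}`.
[cite: Mayer1990, Thm. 5 (proof, p. 327)] -/
theorem differentiableOn_tsum_branchTerm :
    DifferentiableOn ℂ (fun s => ∑' n, branchTerm n s) {s : ℂ | 0 < s.re} := by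
  refine differentiableOn_tsum_of_locally_bounded (E := MayerSpace →L[ℂ] MayerSpace)
    (isOpen_lt continuous_const Complex.continuous_re)
    (fun n => (differentiable_branchTerm n).differentiableOn) ?_
  intro s₀ hs₀
  have hσ₀ : 0 < s₀.re := hs₀
  have h12 : (0 : ℝ) < 1 / 2 := by norm_num
  have h3σ₀ : 0 < 3 * s₀.re := by positivity
  refine ⟨s₀.re / 2, by positivity, fun n => 4 * Real.exp (π * (|s₀.im| + s₀.re / 2)) *
    (((n : ℝ) + 1 / 2) ^ (-(s₀.re + 1)) + ((n : ℝ) + 1 / 2) ^ (-(3 * s₀.re + 1))),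
    ((summable_nat_add_rpow_neg h12 hσ₀).add (summable_nat_add_rpow_neg h12 h3σ₀)).mul_left _,
    fun n s hs _ => ?_⟩
  obtain ⟨h1, h2, h3, -⟩ := bounds_of_mem_ball hs
  have hsre : 0 ≤ s.re := by linarith
  refine (norm_branchTerm_le n hsre).trans ?_
  have hx : (0 : ℝ) < n + 1 / 2 := by positivity
  have hexp : Real.exp (π * |s.im|) ≤ Real.exp (π * (|s₀.im| + s₀.re / 2)) :=
    Real.exp_le_exp.mpr (mul_le_mul_of_nonneg_left h3 pi_pos.le)
  have hpow : ((n : ℝ) + 1 / 2) ^ (-(2 * s.re + 1)) ≤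
      ((n : ℝ) + 1 / 2) ^ (-(s₀.re + 1)) + ((n : ℝ) + 1 / 2) ^ (-(3 * s₀.re + 1)) :=
    rpow_neg_le_add hx (by linarith) (by linarith)
  exact mul_le_mul (mul_le_mul_of_nonneg_left hexp (by norm_num)) hpow
    (Real.rpow_nonneg hx.le _) (by positivity)

/-! ### The Hurwitz part `f ↦ f(0) ζ(2s, · + 1)` -/

/-- The `n`-th term of the series for `ζ(2s, · + 1)` as an element of `B(D)`:
`(· + n + 1)^{-2s} - ((· + n + 2)^{1-2s} - (· + n + 1)^{1-2s})/(1 - 2s)`. [folklore] -/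
def hurwitzTermElt (n : ℕ) (s : ℂ) : MayerSpace :=
  expCurve (logElt n) (-(2 * s)) -
    (1 / (1 - 2 * s)) • (expCurve (logElt (n + 1)) (1 - 2 * s) - expCurve (logElt n) (1 - 2 * s))

/-- Point values: `hurwitzTermElt n s` is `z ↦ hurwitzZetaCTerm (2s) (z + 1) n`. [folklore] -/
theorem hurwitzTermElt_toFun_apply (n : ℕ) (s : ℂ) {z : ℂ} (hz : z ∈ mayerClosedDisc) :
    (hurwitzTermElt n s).toFun z = hurwitzZetaCTerm (2 * s) (z + 1) n := by
  have hb2 : (n : ℂ) + (z + 1) + 1 = z + (((n + 1 : ℕ) : ℂ) + 1) := by push_cast; ring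
  have hb1 : (n : ℂ) + (z + 1) = z + (n + 1) := by ring
  rw [hurwitzZetaCTerm, hb2, hb1, hurwitzTermElt, toFun_sub_apply _ _ hz, toFun_smul_apply _ _ hz,
    toFun_sub_apply _ _ hz, expCurve_logElt_toFun_apply _ _ hz,
    expCurve_logElt_toFun_apply _ _ hz, expCurve_logElt_toFun_apply _ _ hz]
  ring

/-- `s ≠ 1/2 ⇒ 2s ≠ 1`. [folklore] -/
theorem two_mul_ne_one {s : ℂ} (hs : s ≠ 1 / 2) : 2 * s ≠ 1 := fun h =>
  hs (by linear_combination h / 2)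

/-- Sup-norm bound for the Hurwitz terms (`Re s ≥ 0`, `s ≠ 1/2`):
`‖hurwitzTermElt n s‖ ≤ ‖2s‖ e^{π/2 |Im 2s|} (n + 1/2)^{-(Re 2s + 1)}`. [folklore] -/
theorem norm_hurwitzTermElt_le (n : ℕ) {s : ℂ} (hs : s ≠ 1 / 2) (hσ : 0 ≤ s.re) :
    ‖hurwitzTermElt n s‖ ≤ ‖2 * s‖ * Real.exp (π / 2 * |(2 * s).im|) *
      ((n : ℝ) + 1 / 2) ^ (-((2 * s).re + 1)) := by
  have hσ2 : -1 ≤ (2 * s).re := by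
    have h : (2 * s).re = 2 * s.re := by simp
    rw [h]; linarith
  refine norm_le_of_forall_le _ (by positivity) fun z hz => ?_
  rw [hurwitzTermElt_toFun_apply n s hz]
  have ha : 1 / 2 ≤ (z + 1).re := by
    have h1 := re_ge_of_mem_mayerClosedDisc hz
    rw [add_re, one_re]; linarith
  exact norm_hurwitzZetaCTerm_le_of_le_re (two_mul_ne_one hs) hσ2 (by norm_num) ha n

/-- Absolute convergence of `∑ₙ hurwitzTermElt n s` in `B(D)` for `Re s > 0`, `s ≠ 1/2`.
[folklore] -/
theorem summable_hurwitzTermElt {s : ℂ} (hs : s ≠ 1 / 2) (hσ : 0 < s.re) :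
    Summable fun n => hurwitzTermElt n s := by
  have h2 : (0 : ℝ) < (2 * s).re := by
    have h : (2 * s).re = 2 * s.re := by simp
    rw [h]; positivity
  have h12 : (0 : ℝ) < 1 / 2 := by norm_num
  exact Summable.of_norm_bounded (E := MayerSpace)
    ((summable_nat_add_rpow_neg h12 h2).mul_left _) fun n => norm_hurwitzTermElt_le n hs hσ.le

/-- `s ↦ 1/(1 - 2s)` is holomorphic off `s = 1/2`. [folklore] -/
theorem differentiableOn_one_div_one_sub_two_mul :
    DifferentiableOn ℂ (fun s : ℂ => 1 / (1 - 2 * s)) {s : ℂ | s ≠ 1 / 2} := by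
  refine DifferentiableOn.div (differentiableOn_const _) (by fun_prop) fun s hs h => ?_
  exact hs (by linear_combination -h / 2)

/-- `s ↦ 1/(2s - 1)` is holomorphic off `s = 1/2`. [folklore] -/
theorem differentiableOn_one_div_two_mul_sub_one :
    DifferentiableOn ℂ (fun s : ℂ => 1 / (2 * s - 1)) {s : ℂ | s ≠ 1 / 2} := by
  refine DifferentiableOn.div (differentiableOn_const _) (by fun_prop) fun s hs h => ?_
  exact hs (by linear_combination h / 2)

/-- Each Hurwitz term is holomorphic in `s` off `s = 1/2` (as a `B(D)`-valued map). [folklore] -/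
theorem differentiableOn_hurwitzTermElt (n : ℕ) :
    DifferentiableOn ℂ (hurwitzTermElt n) {s : ℂ | s ≠ 1 / 2} := by
  have h1 := (differentiable_expCurve_neg_two_mul (logElt n)).differentiableOn
    (s := {s : ℂ | s ≠ 1 / 2})
  have h2 := ((differentiable_expCurve_one_sub_two_mul (logElt (n + 1))).sub
    (differentiable_expCurve_one_sub_two_mul (logElt n))).differentiableOn
    (s := {s : ℂ | s ≠ 1 / 2})
  have h3 := DifferentiableOn.smul (𝕜 := ℂ) (𝕜' := ℂ) (E := ℂ) (F := MayerSpace)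
    differentiableOn_one_div_one_sub_two_mul h2
  exact h1.sub h3

/-- **`ζ(2s, · + 1)` as an element of `B(D)`**, for every `s` (junk unless `0 < Re s`,
`s ≠ 1/2`): the `B(D)`-valued series `∑ₙ hurwitzTermElt n s + (· + 1)^{1-2s}/(2s - 1)`.
[cite: Mayer1990, eqs. (61), (63)] -/
def hurwitzElt (s : ℂ) : MayerSpace :=
  ∑' n, hurwitzTermElt n s + (1 / (2 * s - 1)) • expCurve (logElt 0) (1 - 2 * s)

/-- Point values: `hurwitzElt s` is `z ↦ ζ(2s, z + 1)` (`0 < Re s`, `s ≠ 1/2`). [folklore] -/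
theorem hurwitzElt_toFun_apply {s : ℂ} (hs : s ≠ 1 / 2) (hσ : 0 < s.re) {z : ℂ}
    (hz : z ∈ mayerClosedDisc) : (hurwitzElt s).toFun z = hurwitzZetaC (2 * s) (z + 1) := by
  rw [hurwitzElt, toFun_add_apply _ _ hz, toFun_tsum_apply (summable_hurwitzTermElt hs hσ) hz,
    toFun_smul_apply _ _ hz, expCurve_logElt_toFun_apply _ _ hz, hurwitzZetaC_def]
  simp only [hurwitzTermElt_toFun_apply _ _ hz, Nat.cast_zero, zero_add]
  ring

/-- **Holomorphy of `s ↦ ζ(2s, · + 1) ∈ B(D)`** on `{0 < Re s} \ {1/2}` (local `M`-test with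
the bracket estimate of the bounds file). [cite: Mayer1990, Thm. 5 (proof, p. 326)] -/
theorem differentiableOn_hurwitzElt :
    DifferentiableOn ℂ hurwitzElt {s : ℂ | 0 < s.re ∧ s ≠ 1 / 2} := by
  have hU : IsOpen {s : ℂ | 0 < s.re ∧ s ≠ 1 / 2} :=
    (isOpen_lt continuous_const Complex.continuous_re).inter isOpen_ne
  have h1 : DifferentiableOn ℂ (fun s => ∑' n, hurwitzTermElt n s)
      {s : ℂ | 0 < s.re ∧ s ≠ 1 / 2} := by
    refine differentiableOn_tsum_of_locally_bounded (E := MayerSpace) hU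
      (fun n => (differentiableOn_hurwitzTermElt n).mono fun s hs => hs.2) ?_
    intro s₀ hs₀
    have hσ₀ : 0 < s₀.re := hs₀.1
    have h12 : (0 : ℝ) < 1 / 2 := by norm_num
    have hp₁ : 0 < s₀.re := hσ₀
    have hp₂ : 0 < 3 * s₀.re := by positivity
    refine ⟨s₀.re / 2, by positivity,
      fun n => 2 * (‖s₀‖ + s₀.re / 2) * Real.exp (π * (|s₀.im| + s₀.re / 2)) *
        (((n : ℝ) + 1 / 2) ^ (-(s₀.re + 1)) + ((n : ℝ) + 1 / 2) ^ (-(3 * s₀.re + 1))),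
      ((summable_nat_add_rpow_neg h12 hp₁).add (summable_nat_add_rpow_neg h12 hp₂)).mul_left _,
      fun n s hs hsW => ?_⟩
    obtain ⟨hb1, hb2, hb3, hb4⟩ := bounds_of_mem_ball hs
    have hsre : 0 ≤ s.re := by linarith
    refine (norm_hurwitzTermElt_le n hsW.2 hsre).trans ?_
    have hx : (0 : ℝ) < n + 1 / 2 := by positivity
    have hns : ‖2 * s‖ ≤ 2 * (‖s₀‖ + s₀.re / 2) := by
      rw [norm_mul, Complex.norm_two]; linarith
    have him : |(2 * s).im| = 2 * |s.im| := by simp [abs_mul]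
    have hre : (2 * s).re = 2 * s.re := by simp
    have hexp : Real.exp (π / 2 * |(2 * s).im|) ≤ Real.exp (π * (|s₀.im| + s₀.re / 2)) := by
      rw [him, Real.exp_le_exp]
      nlinarith [pi_pos]
    have hpow : ((n : ℝ) + 1 / 2) ^ (-((2 * s).re + 1)) ≤
        ((n : ℝ) + 1 / 2) ^ (-(s₀.re + 1)) + ((n : ℝ) + 1 / 2) ^ (-(3 * s₀.re + 1)) := by
      rw [hre]
      exact rpow_neg_le_add hx (by linarith) (by linarith)
    exact mul_le_mul (mul_le_mul hns hexp (Real.exp_pos _).le (by positivity)) hpow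
      (Real.rpow_nonneg hx.le _) (by positivity)
  have h2 : DifferentiableOn ℂ (fun s : ℂ => (1 / (2 * s - 1)) • expCurve (logElt 0) (1 - 2 * s))
      {s : ℂ | 0 < s.re ∧ s ≠ 1 / 2} :=
    DifferentiableOn.smul (𝕜 := ℂ) (𝕜' := ℂ) (E := ℂ) (F := MayerSpace)
      (differentiableOn_one_div_two_mul_sub_one.mono fun s hs => hs.2)
      ((differentiable_expCurve_one_sub_two_mul (logElt 0)).differentiableOn)
  show DifferentiableOn ℂ (fun s => ∑' n, hurwitzTermElt n s +
    (1 / (2 * s - 1)) • expCurve (logElt 0) (1 - 2 * s)) {s : ℂ | 0 < s.re ∧ s ≠ 1 / 2}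
  exact h1.add h2

/-! ### The family `s ↦ L_s` and the proof of `MayerTransferHolomorphic` -/

/-- **Mayer's operator, explicitly** (the `N = 0` decomposition [Mayer1990, (62)]):
`L_s = (f ↦ f(0) ζ(2s, · + 1)) + ∑ₙ A_n(s)`. [cite: Mayer1990, Thm. 5, eq. (62)] -/
def mayerFamily (s : ℂ) : MayerSpace →L[ℂ] MayerSpace :=
  (evalCLM ⟨0, zero_mem_mayerClosedDisc⟩).smulRight (hurwitzElt s) + ∑' n, branchTerm n s

/-- Applying the operator series termwise. [folklore] -/
theorem tsum_branchTerm_apply {s : ℂ} (hs : 0 < s.re) (f : MayerSpace) :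
    (∑' n, branchTerm n s) f = ∑' n, branchTerm n s f := by
  have h := (ContinuousLinearMap.apply ℂ MayerSpace f).map_tsum (summable_branchTerm hs)
  simpa only [ContinuousLinearMap.apply_apply] using h

/-- Summability of `n ↦ A_n(s) f`. [folklore] -/
theorem summable_branchTerm_apply {s : ℂ} (hs : 0 < s.re) (f : MayerSpace) :
    Summable fun n => branchTerm n s f := by
  have h := (ContinuousLinearMap.apply ℂ MayerSpace f).summable (summable_branchTerm hs)
  simpa only [ContinuousLinearMap.apply_apply] using h

/-- **`mayerFamily s` is Mayer's transfer operator `L_s`** for `0 < Re s`, `s ≠ 1/2`: it acts by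
the `κ = 0` continued formula `mayerSum₀`. [cite: Mayer1990, Thm. 5, eqs. (60)–(62)] -/
theorem isMayerTransferAt_mayerFamily {s : ℂ} (hs : s ≠ 1 / 2) (hσ : 0 < s.re) :
    IsMayerTransferAt s (mayerFamily s) := by
  intro f z
  rw [mayerFamily, add_apply, ContinuousLinearMap.smulRight_apply,
    evalCLM_apply, toFun_add_apply _ _ z.2, toFun_smul_apply _ _ z.2,
    hurwitzElt_toFun_apply hs hσ z.2, tsum_branchTerm_apply hσ,
    toFun_tsum_apply (summable_branchTerm_apply hσ f) z.2, mayerSum₀]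
  simp only [branchTerm_toFun_apply _ _ _ z.2, mayerTerm]

/-- `smulRightL c g = c.smulRight g`. [folklore] -/
theorem smulRightL_apply_eq (c : MayerSpace →L[ℂ] ℂ) (g : MayerSpace) :
    ContinuousLinearMap.smulRightL ℂ MayerSpace MayerSpace c g = c.smulRight g := rfl

/-- **Holomorphy of `s ↦ mayerFamily s`** on `{0 < Re s} \ {1/2}` in operator norm.
[cite: Mayer1990, Thm. 5] -/
theorem differentiableOn_mayerFamily :
    DifferentiableOn ℂ mayerFamily {s : ℂ | 0 < s.re ∧ s ≠ 1 / 2} := by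
  set c : MayerSpace →L[ℂ] ℂ := evalCLM ⟨0, zero_mem_mayerClosedDisc⟩ with hc
  have hL := (ContinuousLinearMap.smulRightL ℂ MayerSpace MayerSpace c).differentiable
  have h1 : DifferentiableOn ℂ (fun s => ContinuousLinearMap.smulRightL ℂ MayerSpace MayerSpace c
      (hurwitzElt s)) {s : ℂ | 0 < s.re ∧ s ≠ 1 / 2} :=
    Differentiable.comp_differentiableOn (𝕜 := ℂ) (E := ℂ) (F := MayerSpace)
      (G := MayerSpace →L[ℂ] MayerSpace) hL differentiableOn_hurwitzElt
  have h2 := differentiableOn_tsum_branchTerm.mono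
    (fun s (hs : s ∈ {s : ℂ | 0 < s.re ∧ s ≠ 1 / 2}) => hs.1)
  show DifferentiableOn ℂ (fun s => c.smulRight (hurwitzElt s) + ∑' n, branchTerm n s)
    {s : ℂ | 0 < s.re ∧ s ≠ 1 / 2}
  simp only [← smulRightL_apply_eq]
  exact DifferentiableOn.add (𝕜 := ℂ) (E := ℂ) (F := MayerSpace →L[ℂ] MayerSpace) h1 h2

/-- For `0 < Re s`, `s ≠ 1/2`, `mayerTransfer s` (the operator of the definitions file) is
`mayerFamily s`. [cite: Mayer1990, Thm. 5] -/
theorem mayerTransfer_eq_mayerFamily {s : ℂ} (hs : s ≠ 1 / 2) (hσ : 0 < s.re) :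
    mayerTransfer s = mayerFamily s :=
  mayerTransfer_eq (isMayerTransferAt_mayerFamily hs hσ)

/-- **Mayer's theorem (holomorphy of the transfer operator family)**: `s ↦ L_s` is holomorphic,
as a map into the bounded operators on `B(D)` with the operator norm, on `{0 < Re s} \ {1/2}`.
Discharges the named fact `MayerTransferHolomorphic`. [cite: Mayer1990, Thm. 5] -/
theorem MayerTransferHolomorphic_holds : MayerTransferHolomorphic := by
  unfold MayerTransferHolomorphic
  exact differentiableOn_mayerFamily.congr fun s hs => mayerTransfer_eq_mayerFamily hs.2 hs.1

end Literature.Dynamics.TransferOperators
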